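import Literature.MathematicalPhysics.QuantumFieldTheory.Balaban1983to89.B9SectBGpTransferOutY
import Literature.MathematicalPhysics.QuantumFieldTheory.Balaban1983to89.B9SectBGpReadingsYProd
import Literature.MathematicalPhysics.QuantumFieldTheory.Balaban1983to89.B9Eq370LetterConversion

/-!
# `Balaban1983to89.B9SectBGpTransferConvY` — THE LETTER CONVERSION `hconv` OF THE OUTPUT TRANSFER AT THE RECORD: from the (3.42) block of the
# augmented coded readings `KSC` at a coded product `prod U a` (letters at the base `U`) to the (3.42) block of NODE 00's reading of `G′` AT
# `W = e^{ηa}·U` WITH LETTERS AT `W`, and the hypothesis `hout` of `B9SectBStepFamilyTransfer.sectBStepPrinted_of_family` assembled from it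

T. Bałaban, *Propagators for lattice gauge theories in a background field*, Commun. Math. Phys. **99** (1985) 389–434
[`Balaban1985BackgroundPropagators`, "B9"]; T. Bałaban, *Propagators and renormalization transformations for lattice gauge
theories. II*, Commun. Math. Phys. **96** (1984) 223–250 [`Balaban1984PropagatorsII`, "[4]"].

statement-level skeleton of published theorems with citation tags; proofs where landed; nothing here is a claim about the
Yang–Mills mass gap

THE PRINTED LOCUS.  p. 403 l.1–9 («… we can prove all the statements (3.42)–(3.47) of Theorem 3.1 for the operator G′(U′U), of course with
different constants, although changes are small»), with (3.70) p. 404, (3.74) p. 405, (3.53) p. 400 for the letters at `U′U`, and [4] Lemma 2.1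
p. 234 for the compositions.

WHY THIS FILE (pub-ymgap N06 row 13, seat dag-n06-c g8, INTENT-1 (c)).  `B9SectBGpTransferOutY.thms_pullK_prod_of_KSC` (p578467) reduced the output half
`hout` of the family transfer `B9SectBStepFamilyTransfer.sectBStepPrinted_of_family` to ONE analytic statement per `(U, a)`:
`hconv : EBlock (KSC …) B₀ δ₀ (.prod U a) → EBlock (kernelFamilyS … (GpY par) par) B″ δ″ (mulY … (fluct η a) U)`.  Here it is PROVED, on the
corner-free lineage, by READ (`B9SectBGpReadingsYProd.hasMajorant_letters_prod_of_eBlock`) → CONVERT (`B9Eq370LetterConversion`: left ∕ right ∕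
Laplacian, [4] Lemma 2.1 at exponents `α = β = 1/4`, output rate `δ₀/2`, transports unitary, `α₁ ≦ 1/4`) → WRITE (def-Y's
`Node00.OpsYRead342.eBlock_kernelFamilyS_of_hasMajorant` at `cfg := id`, `U₁ := W`, `Uc := prodCfg (UboxY U) η (chartA a) = UboxY W`).
The (2.61) exponent∕threshold functions are n06-k's (`B9SectBGpFrameCodedY.exists_d261` = `B9RWSums347DefiniteFacesWindow.ineq261_fn_geo9Y` at
`R = 0`), the six scale transfers n06-k's `scaleTransfer6_window_geo9Y` at the floor rate `δ₀/4`; the (3.37) letters come from the coded class through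
the dictionary hypothesis `hC37` of `B9SectBGpFrameCodedY.gpFrame₂Coded` (`C37 β U a → GVal U ∧ CplxLettersY … β U a`).

WHAT THIS FILE PROVES (0 sorry, theorems only):
* §1 `lapLetter_mulY_fluct` — `η⁻²Δ_{U′U} = η⁻²Δ_U − V′₁(A)` as ℝ-linear operators on NODE 00's chart (`B9Eq360DeltaPrimeAY.lapSL_mulY_fluct` scaled);
  `letters337_of_cplxLettersY` — the (3.37) letter bounds of `B9Eq370LetterConversion` (`hA`, `h337s`) read off `CplxLettersY` at a `G`-valued base.
* §2 ★★ `hconv_at` — at ONE member above the thresholds, with (2.61) and the three scale transfers at `(δ₀, 1/4)` given: `EBlock (KSC …) B₀ δ₀ (.prod U a)`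
  ⇒ `EBlock (kernelFamilyS x.toKIdx (bg9Y 𝔸 G x) (fun U => U) (GpY x.toKIdx par) par) (c_R·B_conv) (δ₀/2) (mulY … (fluct η a) U)` for `(U, a)` in the
  coded class at `α₁ ≦ 1/4`, with `B_conv = B_conv(c_R·B₀, δ₀, d, ℓ, dL)` EXPLICIT (sum of the four converted constants).
* §3 ★★ `hconv_KSC` — the family-level statement: for all `B₀ ≧ 0`, `δ₀ > 0` there are a threshold `Mo(δ₀)` and a constant `B″` (uniform in the member)
  such that `hconv` holds at every member above `Mo` — (2.61) and the transfers discharged by n06-k's suppliers.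
* §4 ★★★ `hout_KSC` — the hypothesis `hout` of `sectBStepPrinted_of_family` LITERALLY, for `Gp₁ := KSC`, `Gp₂ := pullK … (kernelFamilyS … (GpY par) par)`,
  any shared `GA` with nonnegative Hölder members and any shared `Cinv` (`hconv_KSC` ∘ `thms_pullK_prod_of_KSC`).

HONEST SCOPE.  Bookkeeping and one estimate of print (the letter conversion, every O(1) explicit) over NODE 00's DEFINED readings; no statement of
Theorem 3.1 is asserted — the (3.42) block at `U′U` with base letters is a HYPOTHESIS (it is what the Sect.-B frames produce); the block labels `ιB`
are a SECTION of `β` (`hι`), which exists exactly at the CORNER-FREE members (`B9BetaRangeKLevelV1.surjective_beta_iff`; this seat's bus line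
LOCATED-7, 2026-08-27: at a cornered member the record's carrier-block reading does not determine the step by any labelling) — every statement
displaying `hι` is about corner-free members; COUNT-NEUTRAL; N06 NOT discharged; one finite lattice programme — nothing continuum ∕ OS ∕ mass-gap ∕
Clay.  Cell `pub-ymgap` (HUMAN RULING D-0062), Track A node N06 [B9], N06-ASSIGNMENT row 13, 2026-08-27.
v1.1 (same seat, same day; DOCSTRINGS ONLY, declarations byte-identical to v1 p583550; ref-E g13 READ-12 GAP-STATED(l.305 ∕ l.344)): THE FAMILY-LEVEL
BINDER `hι : ∀ (x : MemberY …) (s : BlkY x.toKIdx), β … (ιB x s) = s` of §3 `hconv_KSC` and §4 `hout_KSC` (as of `B9SectBGpFrameCodedY.gpFrame₂Coded` and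
`B9SectBGpTransferInY.hin_KSC`) reads «EVERY served member is corner-free» and is REFUTED at the served member type by def-Y's
`Node00.MemberYCornered.not_forall_memberY_beta_section` (cornered members exist at every admissible `(d, L, k ≥ 3, band, Mstar)`): §3–§4 are honest
implications with an antecedent false at `MemberY …`, hence deliver NO family-level `hout` there; they become non-vacuous only over a corner-free
SUB-family (road (ii) of this seat's LOCATED-7) or after a re-homing of the record's reading on 𝔅 (road (i)).  The CONTENT of the file is the per-member
§2 `hconv_at` (its `hι` concerns that member only); whether SOME served member is corner-free is characterised by `B9BetaRangeKLevelV1.surjective_beta_iff`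
and not certified here.

RELATED IN THE TREE, NOT DUPLICATED: `B9SectBGpTransferInY` (`hin_KSC`, the input half), `B9SectBGpTransferOutY` (`thms_pullK_prod_of_KSC`, §3 the
left letter pointwise), `B9SectBStepFamilyTransfer` (the consumer), `B9SectBGpReadingsY(Prod)` (READ), `B9Eq370LetterConversion` (CONVERT),
`Node00.OpsYRead342` (WRITE), `B9RWSums347DefiniteFacesWindow` ∕ `B9SectBGpFrameCodedY.exists_d261` (Lemma 2.1 at the record).
-/

noncomputable section

namespace Literature.MathematicalPhysics.QuantumFieldTheory.Balaban1983to89.B9SectBGpTransferConvY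

open Literature.MathematicalPhysics.QuantumFieldTheory.Balaban1983to89.B6KLevelCensusIndexV1 (KIdx kGeo)
open Literature.MathematicalPhysics.QuantumFieldTheory.Balaban1983to89.B6Ineq2142KLevelV1 (β)
open Literature.MathematicalPhysics.QuantumFieldTheory.Balaban1983to89.B6RandomWalk (HasMajorant hasMajorant_mono Triangle254 Ineq261)
open Literature.MathematicalPhysics.QuantumFieldTheory.Balaban1983to89.B9Thm34Ext (toB6)
open Literature.MathematicalPhysics.QuantumFieldTheory.Balaban1983to89.B9Ineq347 (ScaleTransfer)
open Literature.MathematicalPhysics.QuantumFieldTheory.Balaban1983to89.B9FromB6 (EBlock)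
open Literature.MathematicalPhysics.QuantumFieldTheory.Balaban1983to89.B9Eq39Adjoint (fluct prodCfg covD covDstar)
open Literature.MathematicalPhysics.QuantumFieldTheory.Balaban1983to89.B9Eq352DivForm (tauB)
open Literature.MathematicalPhysics.QuantumFieldTheory.Balaban1983to89.B9Eq352DivFormLetters (conj)
open Literature.MathematicalPhysics.QuantumFieldTheory.Balaban1983to89.B9Eq352GradLetters (V1pOp diffLetter)
open Literature.MathematicalPhysics.QuantumFieldTheory.Balaban1983to89.B9Ineq385VG (kappa385 kappa385_nonneg)
open Literature.MathematicalPhysics.QuantumFieldTheory.Balaban1983to89.B9SectBCodedCarrier (CCfg pullK)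
open Literature.MathematicalPhysics.QuantumFieldTheory.Balaban1983to89.B9Eq360DeltaPrimeAY (AfldY mulY chartA UboxY_mulY_fluct lapSL_mulY_fluct)
open Literature.MathematicalPhysics.QuantumFieldTheory.Balaban1983to89.B9PinMembersKLevelV1 (MemberY geo9Y bg9Y)
open Literature.MathematicalPhysics.QuantumFieldTheory.Balaban1983to89.B9SectBGpLettersY (GVal coordC expAC blkC norm_le_one_and_inv_of_mem
  letters_base_of_gVal stencilF_blkC stencilB_blkC stencil0_geo9K)
open Literature.MathematicalPhysics.QuantumFieldTheory.Balaban1983to89.B9SectBGpFrameCodedY (codingYx CplxLettersY exists_d261)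
open Literature.MathematicalPhysics.QuantumFieldTheory.Balaban1983to89.B9SectBGpReadingsY (KSC etaS_eq_eta)
open Literature.MathematicalPhysics.QuantumFieldTheory.Balaban1983to89.B9SectBGpReadingsYProd (hasMajorant_letters_prod_of_eBlock)
open Literature.MathematicalPhysics.QuantumFieldTheory.Balaban1983to89.B9SectBGpTransferOutY (thms_pullK_prod_of_KSC)
open Literature.MathematicalPhysics.QuantumFieldTheory.Balaban1983to89.B9Eq370LetterConversion (hasMajorant_diffLetter_prodCfg_mul
  hasMajorant_mul_diffLetter_prodCfg hasMajorant_lap_prodCfg_mul)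
open Literature.MathematicalPhysics.QuantumFieldTheory.Balaban1983to89.B9Ineq366CPrime (hasMajorant_rate_mono)
open Literature.MathematicalPhysics.QuantumFieldTheory.Balaban1983to89.B9RWSums347DefiniteFacesWindow (scaleTransfer6_window_geo9Y geo9Y_dist_nonneg)
open Literature.MathematicalPhysics.QuantumFieldTheory.Balaban1983to89.B9GeoLemma21KLevelV1 (geo9Y_len_pos geo9Y_dist_triangle geo9K_eta_pos geo9K_one_le_L)
open Literature.MathematicalPhysics.QuantumFieldTheory.Balaban1983to89.Node00 (SiteY BlkY IBondY CfgY SiteParY UboxY shiftY kernelFamilyS GpY lapSL etaS)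
open Literature.MathematicalPhysics.QuantumFieldTheory.Balaban1983to89.Node00.OpsYRead342 (eBlock_kernelFamilyS_of_hasMajorant)

variable {𝔸 : Type} [NormedRing 𝔸] [NormedAlgebra ℂ 𝔸] [CompleteSpace 𝔸] [FiniteDimensional ℝ 𝔸]
variable {d ℓ : ℕ} {hd : 1 ≤ d + 1} {hL : Odd (ℓ + 1) ∧ 1 < ℓ + 1} {b₀ b₁ : ℝ} {Mstar : ℕ}

/-! ## §1 The Laplacian letters at `U′U` and the (3.37) letters at a `G`-valued base -/

section Letters

variable (G : Subgroup 𝔸ˣ) (x : MemberY d ℓ hd hL b₀ b₁ Mstar) (par : SiteParY 𝔸 x.toKIdx) {ι : Type} [Fintype ι] (b : Module.Basis ι ℝ 𝔸)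
  (ιB : BlkY x.toKIdx → IBondY x.toKIdx)

omit [FiniteDimensional ℝ 𝔸] in
/-- **(3.53) IN PRINT'S UNITS ON NODE 00's CHART, AS ℝ-LINEAR OPERATORS**: `η⁻²Δ_{U′U} = η⁻²Δ_U − V′₁(A)` (`U′ = e^{iηa}`, `A = chartA a`, `η = (kGeo x).eta`)
— `B9Eq360DeltaPrimeAY.lapSL_mulY_fluct` multiplied by `η⁻²`; the hypothesis `hL` of `B9Eq370LetterConversion.hasMajorant_lap_prodCfg_mul`.
[cite: Balaban1985BackgroundPropagators, (3.53) p.400, (3.23) p.394] -/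
theorem lapLetter_mulY_fluct (a : AfldY 𝔸 x.toKIdx) (U : CfgY 𝔸 x.toKIdx) :
    ((kGeo x.toKIdx).eta ^ 2)⁻¹ • (lapSL x.toKIdx (mulY x.toKIdx (fluct (kGeo x.toKIdx).eta a) U)).restrictScalars ℝ
      = ((kGeo x.toKIdx).eta ^ 2)⁻¹ • (lapSL x.toKIdx U).restrictScalars ℝ
        - V1pOp (shiftY x.toKIdx) (UboxY x.toKIdx U) (kGeo x.toKIdx).eta (chartA x.toKIdx a) := by
  have hη : (kGeo x.toKIdx).eta ≠ 0 := (geo9K_eta_pos x.toKIdx).ne'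
  have hη2 : ((kGeo x.toKIdx).eta ^ 2 : ℝ) ≠ 0 := pow_ne_zero 2 hη
  rw [lapSL_mulY_fluct x.toKIdx hη a U, smul_sub, smul_smul, inv_mul_cancel₀ hη2, one_smul]

omit [FiniteDimensional ℝ 𝔸] in
/-- **THE (3.37) LETTERS OF THE CONVERSION AT A `G`-VALUED BASE**: from `CplxLettersY … Cq β U a` (the coded class read as letter bounds) and `β ≦ α`,
the hypotheses `hA` (‖A_μ(z)‖, ‖τ*_μA_μ(z)‖ ≦ α·ℓ(y(z))⁻¹) and `h337s` (‖η⁻¹D*_{U,μ}A_μ(z)‖ ≦ α·ℓ(y(z))⁻²) of `B9Eq370LetterConversion` for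
`A = chartA a`, transports `UboxY U`. [cite: Balaban1985BackgroundPropagators, (3.37) p.396, p.397 (sentence after (3.41))] -/
theorem letters337_of_cplxLettersY {Cq β α : ℝ} (hβα : β ≤ α) {U : CfgY 𝔸 x.toKIdx} (hU : GVal G x.toKIdx U) {a : AfldY 𝔸 x.toKIdx}
    (h : CplxLettersY G x par ιB Cq β U a) :
    (∀ (μ : Fin (d + 1)) (z : SiteY x.toKIdx),
        ‖chartA x.toKIdx a μ z‖ ≤ α * ((geo9Y x).len (blkC x.toKIdx ιB z))⁻¹ ∧
          ‖tauB (shiftY x.toKIdx) (UboxY x.toKIdx U) μ (chartA x.toKIdx a μ) z‖ ≤ α * ((geo9Y x).len (blkC x.toKIdx ιB z))⁻¹) ∧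
      (∀ (μ : Fin (d + 1)) (z : SiteY x.toKIdx),
        ‖((((kGeo x.toKIdx).eta : ℂ))⁻¹) • covDstar (shiftY x.toKIdx) (UboxY x.toKIdx U) μ (chartA x.toKIdx a μ) z‖
          ≤ α * ((geo9Y x).len (blkC x.toKIdx ιB z) ^ 2)⁻¹) := by
  have hco : coordC G x.toKIdx (.base U) = UboxY x.toKIdx U := (letters_base_of_gVal G x.toKIdx par hU).1
  have hexp : expAC x.toKIdx (.base U) (.mult a) = chartA x.toKIdx a := rfl
  obtain ⟨-, -, h3, -, -, h6, h7⟩ := h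
  rw [hco, hexp] at h3 h7
  rw [hexp] at h6
  have hw1 : ∀ z : SiteY x.toKIdx, 0 ≤ ((geo9Y x).len (blkC x.toKIdx ιB z))⁻¹ := fun z => inv_nonneg.mpr (geo9Y_len_pos x _).le
  have hw2 : ∀ z : SiteY x.toKIdx, 0 ≤ ((geo9Y x).len (blkC x.toKIdx ιB z) ^ 2)⁻¹ := fun z => inv_nonneg.mpr (sq_nonneg _)
  refine ⟨fun μ z => ⟨(h6 μ z).trans (mul_le_mul_of_nonneg_right hβα (hw1 z)), (h7 μ μ z).trans (mul_le_mul_of_nonneg_right hβα (hw1 z))⟩,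
    fun μ z => (h3 μ μ z).trans (mul_le_mul_of_nonneg_right hβα (hw2 z))⟩

end Letters

/-! ## §2 ★★ The conversion at one member, thresholds and Lemma-2.1 data given -/

section Member

variable (G : Subgroup 𝔸ˣ) (x : MemberY d ℓ hd hL b₀ b₁ Mstar) (par : SiteParY 𝔸 x.toKIdx) {ι : Type} [Fintype ι] (b : Module.Basis ι ℝ 𝔸)
  (ιB : BlkY x.toKIdx → IBondY x.toKIdx) [Fintype (geo9Y x).Site] (C37 C38 : ℝ → CfgY 𝔸 x.toKIdx → AfldY 𝔸 x.toKIdx → Prop)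

/-- ★★ **THE LETTER CONVERSION `hconv` AT ONE MEMBER.**  Data: unit-norm structure group (`hG1`), a section `ιB` of `β` (`hι`), a real basis with coordinate
constant `M₂`, the coded-class dictionary `hC37`; Lemma 2.1 of [4] at the input rate `δ₀` and exponent `1/4` (`h261`) with exponent `dL`, and the scale
transfers of `ℓ, ℓ², ℓ⁻¹` at `(δ₀, 1/4)` with constant `Λ ≧ 0` (`hT1 hT2 hTi`).  Then for `(U, a)` in the coded class at `0 < α₁ ≦ 1/4` and `B₀ ≧ 0`:
`EBlock (KSC …) B₀ δ₀ (.prod U a)` ⇒ the record's (3.42) block AT `W = e^{ηa}·U` with letters AT `W`, constant `c_R·B_conv` and rate `δ₀/2`, where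
`c_R = M₂Σ‖b_j‖` and `B_conv = B_in + B_L + B_R + B_Δ` is the sum of the four converted constants (`B_in = c_R·B₀`; `B_L`, `B_R` from
`hasMajorant_diffLetter_prodCfg_mul ∕ hasMajorant_mul_diffLetter_prodCfg` at `α₁ := 1/4`, `ρu := 1`, `d₀ := 2(d+1)`; `B_Δ` from `hasMajorant_lap_prodCfg_mul`).
[cite: Balaban1985BackgroundPropagators, p.403 l.1–9, (3.70) p.404, (3.74) p.405, (3.53) p.400, (3.42) p.397, (3.37) p.396; Balaban1984PropagatorsII, Lemma 2.1 p.234, (2.51)–(2.55) p.232] -/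
theorem hconv_at (hι : ∀ s : BlkY x.toKIdx, β x.toKIdx.hN x.toKIdx.D x.toKIdx.hk (ιB s) = s)
    (hG1 : ∀ u : 𝔸ˣ, u ∈ G → ‖(u : 𝔸)‖ ≤ 1) {M₂ : ℝ} (hM₂ : 0 ≤ M₂) (hrepr : ∀ (v : 𝔸) (j : ι), |b.repr v j| ≤ M₂ * ‖v‖)
    {Cq : ℝ} (hC37 : ∀ β' U a, C37 β' U a → GVal G x.toKIdx U ∧ CplxLettersY G x par ιB Cq β' U a)
    {δ₀ : ℝ} (hδ₀ : 0 < δ₀) {dL : ℕ} (h261 : Ineq261 dL (toB6 (geo9Y x) (0 : ℝ) True) δ₀ (1 / 4)) {Λ : ℝ} (hΛ : 0 ≤ Λ)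
    (hT1 : ScaleTransfer (geo9Y x) δ₀ (1 / 4) Λ (fun a => (geo9Y x).len a))
    (hT2 : ScaleTransfer (geo9Y x) δ₀ (1 / 4) Λ (fun a => (geo9Y x).len a ^ 2))
    (hTi : ScaleTransfer (geo9Y x) δ₀ (1 / 4) Λ (fun a => ((geo9Y x).len a)⁻¹))
    {B₀ : ℝ} (hB₀ : 0 ≤ B₀) {U : CfgY 𝔸 x.toKIdx} {a : AfldY 𝔸 x.toKIdx} {α₁ : ℝ} (hα₁c : α₁ ≤ 1 / 4) (hC : C37 α₁ U a)
    (hE : EBlock (KSC G x par C37 C38) B₀ δ₀ (.prod U a)) :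
    EBlock (kernelFamilyS x.toKIdx (bg9Y 𝔸 G x) (fun U => U) (GpY x.toKIdx par) par)
      (M₂ * (∑ j, ‖b j‖) *
        ((M₂ * (∑ j, ‖b j‖) * B₀)
          + (1 + (4 * (1 : ℝ) ^ 2 * M₂ * (∑ j, ‖b j‖) * Real.exp (δ₀ * (2 * ((d : ℝ) + 1)))) * (1 / 4) * Λ * B6.c1 dL δ₀ (1 / 4)) *
              (M₂ * (∑ j, ‖b j‖) * B₀)
          + (1 + (4 * (1 : ℝ) ^ 2 * M₂ * (∑ j, ‖b j‖) * Real.exp (δ₀ / 2 * (2 * ((d : ℝ) + 1)))) * (1 / 4) * Λ * B6.c1 dL δ₀ (1 / 4)) *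
              (M₂ * (∑ j, ‖b j‖) * B₀)
          + ((M₂ * (∑ j, ‖b j‖) * B₀)
              + kappa385 (M₂ * (∑ j, ‖b j‖) * B₀)
                  ((((2 + 8 * (1 : ℝ) ^ 2 * (1 / 4)) * Fintype.card (Fin (d + 1)) + 2 * Fintype.card (Fin (d + 1)) * 2) * M₂ * (∑ j, ‖b j‖) *
                    Real.exp (δ₀ * (2 * ((d : ℝ) + 1))))) 0 0 Λ (B6.c1 dL δ₀ (1 / 4)) * (1 / 4))))
      (δ₀ / 2) (mulY x.toKIdx (fluct (kGeo x.toKIdx).eta a) U) := by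
  -- names for the constants
  set cR : ℝ := M₂ * (∑ j, ‖b j‖) with hcR
  set Bin : ℝ := cR * B₀ with hBin
  set d₀ : ℝ := 2 * ((d : ℝ) + 1) with hd₀
  set c₁ : ℝ := B6.c1 dL δ₀ (1 / 4) with hc₁
  set BL : ℝ := (1 + (4 * (1 : ℝ) ^ 2 * M₂ * (∑ j, ‖b j‖) * Real.exp (δ₀ * d₀)) * (1 / 4) * Λ * c₁) * Bin with hBL
  set BR : ℝ := (1 + (4 * (1 : ℝ) ^ 2 * M₂ * (∑ j, ‖b j‖) * Real.exp (δ₀ / 2 * d₀)) * (1 / 4) * Λ * c₁) * Bin with hBR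
  set cV : ℝ := (((2 + 8 * (1 : ℝ) ^ 2 * (1 / 4)) * Fintype.card (Fin (d + 1)) + 2 * Fintype.card (Fin (d + 1)) * 2) * M₂ * (∑ j, ‖b j‖) *
    Real.exp (δ₀ * d₀)) with hcV
  set BΔ : ℝ := Bin + kappa385 Bin cV 0 0 Λ c₁ * (1 / 4) with hBΔ
  set η : ℝ := (kGeo x.toKIdx).eta with hηdef
  set W : CfgY 𝔸 x.toKIdx := mulY x.toKIdx (fluct η a) U with hW
  -- signs
  have hSb : 0 ≤ ∑ j, ‖b j‖ := Finset.sum_nonneg fun j _ => norm_nonneg _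
  have hcR0 : 0 ≤ cR := mul_nonneg hM₂ hSb
  have hBin0 : 0 ≤ Bin := mul_nonneg hcR0 hB₀
  have hc₁0 : 0 ≤ c₁ := B6RandomWalk.c1_nonneg dL δ₀ (1 / 4)
  have hcard : (0 : ℝ) ≤ Fintype.card (Fin (d + 1)) := Nat.cast_nonneg _
  have hBL0 : 0 ≤ BL := by positivity
  have hBR0 : 0 ≤ BR := by positivity
  have hcV0 : 0 ≤ cV := by positivity
  have hκ0 : 0 ≤ kappa385 Bin cV 0 0 Λ c₁ := kappa385_nonneg hBin0 hcV0 le_rfl le_rfl hΛ hc₁0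
  have hBΔ0 : 0 ≤ BΔ := by positivity
  -- geometry of the member
  have hη0 : 0 < η := geo9K_eta_pos x.toKIdx
  have hdnn : ∀ y y' : (geo9Y x).Site, 0 ≤ (geo9Y x).dist y y' := geo9Y_dist_nonneg x
  have htri : Triangle254 (toB6 (geo9Y x) (0 : ℝ) True) := fun p q r => geo9Y_dist_triangle x p q r
  have hlen : ∀ y : (geo9Y x).Site, 0 < (geo9Y x).len y := geo9Y_len_pos x
  have hd₀F : ∀ (μ : Fin (d + 1)) (z : SiteY x.toKIdx), (geo9Y x).dist (blkC x.toKIdx ιB z) (blkC x.toKIdx ιB (shiftY x.toKIdx μ z)) ≤ d₀ ∧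
      (geo9Y x).dist (blkC x.toKIdx ιB z) (blkC x.toKIdx ιB ((shiftY x.toKIdx μ).symm z)) ≤ d₀ :=
    fun μ z => ⟨stencilF_blkC x.toKIdx ιB hι μ z, stencilB_blkC x.toKIdx ιB hι μ z⟩
  have hd₀0 : ∀ y : (geo9Y x).Site, (geo9Y x).dist y y ≤ d₀ := fun y => stencil0_geo9K x.toKIdx y
  -- the class: `U` is `G`-valued, the (3.37) letters at `α₁ ≤ 1/4`
  obtain ⟨hU, hcl⟩ := hC37 α₁ U a hC
  obtain ⟨hA, h337s⟩ := letters337_of_cplxLettersY G x par ιB hα₁c hU hcl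
  have hρu : ∀ (μ : Fin (d + 1)) (z : SiteY x.toKIdx), ‖((UboxY x.toKIdx U μ z : 𝔸ˣ) : 𝔸)‖ ≤ 1 ∧ ‖(((UboxY x.toKIdx U μ z)⁻¹ : 𝔸ˣ) : 𝔸)‖ ≤ 1 :=
    fun μ z => norm_le_one_and_inv_of_mem G hG1 (hU μ _ : UboxY x.toKIdx U μ z ∈ G)
  have hsmall : ∀ y : (geo9Y x).Site, η * ((1 / 4 : ℝ) * ((geo9Y x).len y)⁻¹) ≤ 1 / 4 := by
    intro y
    have hηle : η ≤ (geo9Y x).len y := by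
      show (geo9Y x).eta ≤ (geo9Y x).L ^ (geo9Y x).scale y * (geo9Y x).eta
      exact le_mul_of_one_le_left (geo9K_eta_pos x.toKIdx).le (one_le_pow₀ (geo9K_one_le_L x.toKIdx))
    have hl := hlen y
    rw [show η * ((1 / 4 : ℝ) * ((geo9Y x).len y)⁻¹) = (1 / 4) * (η / (geo9Y x).len y) by ring]
    have : η / (geo9Y x).len y ≤ 1 := (div_le_one hl).mpr hηle
    linarith
  -- READ: the four block majorants at the product, letters at `U`, rate δ₀, constant `Bin`
  obtain ⟨h0, h1, h2, h3⟩ := hasMajorant_letters_prod_of_eBlock G x par b ιB C37 C38 (Rr := (0 : ℝ)) (Hp := True) hι M₂ hM₂ hrepr U a hB₀ hE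
  -- rates
  have hρ : 0 ≤ δ₀ / 2 := by linarith
  have hr : δ₀ / 2 + (1 / 4 + 1 / 4) * δ₀ ≤ δ₀ := by linarith
  have hρδ : δ₀ / 2 ≤ δ₀ := by linarith
  -- CONVERT, left: `∇_{W,μ}·η²G′(W)` for every `k` (only `inl` is written)
  have hLeft : ∀ k : Fin (d + 1) ⊕ Fin (d + 1), HasMajorant (g := toB6 (geo9Y x) (0 : ℝ) True) (fun p : SiteY x.toKIdx × ι => blkC x.toKIdx ιB p.1)
      (conj b (diffLetter (shiftY x.toKIdx) (prodCfg (UboxY x.toKIdx U) η (chartA x.toKIdx a)) (((η : ℂ))⁻¹) k) *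
        conj b ((η ^ 2) • (GpY x.toKIdx par W).restrictScalars ℝ))
      (fun p q => BL * (geo9Y x).len p * Real.exp (-(δ₀ / 2 * (geo9Y x).dist p q))) := fun k => by
    refine hasMajorant_diffLetter_prodCfg_mul b (shiftY x.toKIdx) (UboxY x.toKIdx U) (Rr := (0 : ℝ)) (H := True) (g := geo9Y x)
      (fun z => blkC x.toKIdx ιB z) dL hη0
      (chartA x.toKIdx a) 1 d₀ M₂ (1 / 4) δ₀ δ₀ (1 / 4) (1 / 4) (δ₀ / 2) Λ Bin (by norm_num) hδ₀.le hM₂ hBin0 hΛ hρ hr hρδ hrepr hdnn htri hlen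
      h261 hT2 hsmall hA hρu hd₀F k (Gp := conj b ((η ^ 2) • (GpY x.toKIdx par W).restrictScalars ℝ)) ?_ ?_
    · exact h0
    · exact h1 k
  -- CONVERT, right: `η²G′(W)·∇♯_{W,k}`
  have hRight : ∀ k : Fin (d + 1) ⊕ Fin (d + 1), HasMajorant (g := toB6 (geo9Y x) (0 : ℝ) True) (fun p : SiteY x.toKIdx × ι => blkC x.toKIdx ιB p.1)
      (conj b ((η ^ 2) • (GpY x.toKIdx par W).restrictScalars ℝ) *
        conj b (diffLetter (shiftY x.toKIdx) (prodCfg (UboxY x.toKIdx U) η (chartA x.toKIdx a)) (((η : ℂ))⁻¹) k))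
      (fun p q => BR * (geo9Y x).len p * Real.exp (-(δ₀ / 2 * (geo9Y x).dist p q))) := fun k => by
    refine hasMajorant_mul_diffLetter_prodCfg b (shiftY x.toKIdx) (UboxY x.toKIdx U) (Rr := (0 : ℝ)) (H := True) (g := geo9Y x)
      (fun z => blkC x.toKIdx ιB z) dL hη0
      (chartA x.toKIdx a) 1 d₀ M₂ (1 / 4) δ₀ δ₀ (1 / 4) (1 / 4) (δ₀ / 2) Λ Bin (by norm_num) hM₂ hBin0 hΛ hρ hr hρδ hrepr hdnn htri hlen
      h261 hTi hsmall hA hρu hd₀F k (Gp := conj b ((η ^ 2) • (GpY x.toKIdx par W).restrictScalars ℝ)) ?_ ?_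
    · exact h0
    · exact h2 k
  -- CONVERT, Laplacian: `η⁻²Δ_W·η²G′(W)`
  have hLap : HasMajorant (g := toB6 (geo9Y x) (0 : ℝ) True) (fun p : SiteY x.toKIdx × ι => blkC x.toKIdx ιB p.1)
      (conj b ((η ^ 2)⁻¹ • (lapSL x.toKIdx W).restrictScalars ℝ) * conj b ((η ^ 2) • (GpY x.toKIdx par W).restrictScalars ℝ))
      (fun p q => BΔ * 1 * Real.exp (-(δ₀ / 2 * (geo9Y x).dist p q))) := by
    refine hasMajorant_lap_prodCfg_mul b (shiftY x.toKIdx) (UboxY x.toKIdx U) (Rr := (0 : ℝ)) (H := True) (g := geo9Y x)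
      (fun z => blkC x.toKIdx ιB z) dL hη0
      (chartA x.toKIdx a) 1 d₀ M₂ (1 / 4) δ₀ δ₀ (1 / 4) (1 / 4) (δ₀ / 2) Λ Bin (by norm_num) hδ₀.le hM₂ hBin0 hΛ hρ (by norm_num) (by norm_num) hδ₀.le
      hr hrepr hdnn htri hlen h261 hT1 hT2 hsmall hA h337s hρu hd₀F hd₀0
      (Gp := conj b ((η ^ 2) • (GpY x.toKIdx par W).restrictScalars ℝ))
      (LU := (η ^ 2)⁻¹ • (lapSL x.toKIdx U).restrictScalars ℝ) (LW := (η ^ 2)⁻¹ • (lapSL x.toKIdx W).restrictScalars ℝ)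
      (lapLetter_mulY_fluct x a U) ?_ (fun k => ?_) ?_
    · exact h0
    · exact h1 k
    · exact h3
  -- entry 0 at the smaller rate
  have hZero : HasMajorant (g := toB6 (geo9Y x) (0 : ℝ) True) (fun p : SiteY x.toKIdx × ι => blkC x.toKIdx ιB p.1)
      (conj b ((η ^ 2) • (GpY x.toKIdx par W).restrictScalars ℝ))
      (fun p q => Bin * (geo9Y x).len p ^ 2 * Real.exp (-(δ₀ / 2 * (geo9Y x).dist p q))) :=
    hasMajorant_rate_mono (R := (0 : ℝ)) (H := True) (g := geo9Y x) _ Bin (fun p => (geo9Y x).len p ^ 2) hBin0 (fun p => sq_nonneg _) hρδ hdnn h0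
  -- the common constant
  set Bc : ℝ := Bin + BL + BR + BΔ with hBc
  have hBc0 : 0 ≤ Bc := by positivity
  have hle0 : Bin ≤ Bc := by rw [hBc]; linarith
  have hleL : BL ≤ Bc := by rw [hBc]; linarith
  have hleR : BR ≤ Bc := by rw [hBc]; linarith
  have hleΔ : BΔ ≤ Bc := by rw [hBc]; linarith
  have mono : ∀ {T : Module.End ℝ (SiteY x.toKIdx × ι → ℝ)} {B : ℝ} (w : (geo9Y x).Site → ℝ), (∀ p, 0 ≤ w p) → B ≤ Bc →
      HasMajorant (g := toB6 (geo9Y x) (0 : ℝ) True) (fun p : SiteY x.toKIdx × ι => blkC x.toKIdx ιB p.1) T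
        (fun p q => B * w p * Real.exp (-(δ₀ / 2 * (geo9Y x).dist p q))) →
      HasMajorant (g := toB6 (geo9Y x) (0 : ℝ) True) (fun p : SiteY x.toKIdx × ι => blkC x.toKIdx ιB p.1) T
        (fun p q => Bc * w p * Real.exp (-(δ₀ / 2 * (geo9Y x).dist p q))) := by
    intro T B w hw hB h
    exact hasMajorant_mono (g := toB6 (geo9Y x) (0 : ℝ) True) _ h fun p q =>
      mul_le_mul_of_nonneg_right (mul_le_mul_of_nonneg_right hB (hw p)) (Real.exp_nonneg _)
  -- WRITE at `W` (def-Y), `cfg := id`, `Uc := prodCfg (UboxY U) η (chartA a) = UboxY W`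
  letI : Fintype (B9GeoNormsKLevelV1.geo9K x.toKIdx).Site := ‹Fintype (geo9Y x).Site›
  have hwrite := eBlock_kernelFamilyS_of_hasMajorant x.toKIdx b (B := bg9Y 𝔸 G x) (cfg := fun V => V) (O := GpY x.toKIdx par) (par := par)
    (U₁ := W) (Rr := (0 : ℝ)) (Hp := True) ιB hι hM₂ hrepr (η := η) (by rw [hηdef, etaS_eq_eta])
    (Uc := prodCfg (UboxY x.toKIdx U) η (chartA x.toKIdx a)) (by rw [hW, hηdef, UboxY_mulY_fluct])
    ((η ^ 2) • (GpY x.toKIdx par W).restrictScalars ℝ) ((η ^ 2)⁻¹ • (lapSL x.toKIdx W).restrictScalars ℝ) (fun Λ' => rfl)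
    (fun Λ' => by rw [LinearMap.smul_apply, LinearMap.restrictScalars_apply, Node00.lapSL_apply]) hBc0
    (mono (fun p => (geo9Y x).len p ^ 2) (fun p => sq_nonneg _) hle0 hZero)
    (fun μ => mono (fun p => (geo9Y x).len p) (fun p => (hlen p).le) hleL (hLeft (Sum.inl μ)))
    (fun μ => mono (fun p => (geo9Y x).len p) (fun p => (hlen p).le) hleR (hRight (Sum.inr μ)))
    (mono (fun _ => (1 : ℝ)) (fun _ => zero_le_one) hleΔ hLap)
  simpa only [hBc, hBin, hBL, hBR, hBΔ, hcV, hc₁, hd₀, hcR] using hwrite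

end Member

/-! ## §3 ★★ The conversion at the family level: thresholds and Lemma-2.1 data from n06-k's suppliers -/

section Family

variable [∀ x : MemberY d ℓ hd hL b₀ b₁ Mstar, Fintype (geo9Y x).Site] (G : Subgroup 𝔸ˣ)
  (par : ∀ x : MemberY d ℓ hd hL b₀ b₁ Mstar, SiteParY 𝔸 x.toKIdx) {ι : Type} [Fintype ι] (b : Module.Basis ι ℝ 𝔸)
  (ιB : ∀ x : MemberY d ℓ hd hL b₀ b₁ Mstar, BlkY x.toKIdx → IBondY x.toKIdx)
  (C37 C38 : ∀ x : MemberY d ℓ hd hL b₀ b₁ Mstar, ℝ → CfgY 𝔸 x.toKIdx → AfldY 𝔸 x.toKIdx → Prop)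

/-- ★★ **`hconv` AT THE FAMILY LEVEL**: for every `B₀ ≧ 0` and input rate `δ₀ > 0` there are an M-threshold `Mo(δ₀)` (n06-k's (2.61) threshold `M261 δ₀` ∨ the
scale-transfer size condition `16·log(ℓ+1)∕δ₀`) and a constant `B″ ≧ 0`, UNIFORM IN THE MEMBER, such that at every member above `Mo`, every `(U, a)` in the
coded class at `α₁ ≦ 1/4`: `EBlock (KSC …) B₀ δ₀ (.prod U a) → EBlock (kernelFamilyS … (GpY par) par) B″ (δ₀/2) (e^{ηa}·U)` — the displayed hypothesis
`hconv` of `B9SectBGpTransferOutY.thms_pullK_prod_of_KSC`, proved on the corner-free lineage.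
[cite: Balaban1985BackgroundPropagators, p.403 l.1–9, (3.70) p.404, (3.74) p.405, (3.53) p.400, (3.42) p.397; Balaban1984PropagatorsII, Lemma 2.1 (2.59)–(2.61) pp.233–234] -/
theorem hconv_KSC (hG1 : ∀ u : 𝔸ˣ, u ∈ G → ‖(u : 𝔸)‖ ≤ 1) {M₂ : ℝ} (hM₂ : 0 ≤ M₂) (hrepr : ∀ (v : 𝔸) (j : ι), |b.repr v j| ≤ M₂ * ‖v‖)
    (hι : ∀ (x : MemberY d ℓ hd hL b₀ b₁ Mstar) (s : BlkY x.toKIdx), β x.toKIdx.hN x.toKIdx.D x.toKIdx.hk (ιB x s) = s)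
    {Cq : ℝ} (hC37 : ∀ x β' U a, C37 x β' U a → GVal G x.toKIdx U ∧ CplxLettersY G x (par x) (ιB x) Cq β' U a) :
    ∀ (B₀ δ₀ : ℝ), 0 ≤ B₀ → 0 < δ₀ → ∃ (Mo B'' : ℝ), 0 ≤ B'' ∧
      ∀ x : MemberY d ℓ hd hL b₀ b₁ Mstar, Mo ≤ (geo9Y x).M → ∀ (U : CfgY 𝔸 x.toKIdx) (a : AfldY 𝔸 x.toKIdx) (α₁ : ℝ), α₁ ≤ 1 / 4 → C37 x α₁ U a →
        EBlock (KSC G x (par x) (C37 x) (C38 x)) B₀ δ₀ (.prod U a) →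
        EBlock (kernelFamilyS x.toKIdx (bg9Y 𝔸 G x) (fun U => U) (GpY x.toKIdx (par x)) (par x)) B'' (δ₀ / 2)
          (mulY x.toKIdx (fluct (kGeo x.toKIdx).eta a) U) := by
  obtain ⟨d261, M261, h261f⟩ := exists_d261 (d := d) (ℓ := ℓ) (hd := hd) (hL := hL) (b₀ := b₀) (b₁ := b₁) (Mstar := Mstar)
  intro B₀ δ₀ hB₀ hδ₀
  have hκlo : 0 < 1 / 4 * δ₀ := by positivity
  refine ⟨max (M261 δ₀) (4 * Real.log ((ℓ : ℝ) + 1) / (1 / 4 * δ₀)), ?_, ?_, ?_⟩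
  pick_goal 3
  · intro x hM U a α₁ hα₁c hC hE
    have hM1 : M261 δ₀ ≤ (geo9Y x).M := le_trans (le_max_left _ _) hM
    have hM2 : 4 * Real.log ((ℓ : ℝ) + 1) / (1 / 4 * δ₀) ≤ (geo9Y x).M := le_trans (le_max_right _ _) hM
    have h261 := h261f x δ₀ (1 / 4) hδ₀ (by norm_num) (by norm_num) hM1
    have hST := scaleTransfer6_window_geo9Y hκlo x (δ := δ₀) (α := 1 / 4) le_rfl hM2
    exact hconv_at G x (par x) b (ιB x) (C37 x) (C38 x) (hι x) hG1 hM₂ hrepr (hC37 x) hδ₀ h261 (Λ := ((ℓ : ℝ) + 1) ^ 4) (by positivity)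
      hST.1 hST.2.1 hST.2.2.1 hB₀ hα₁c hC hE
  · have hSb : 0 ≤ ∑ j, ‖b j‖ := Finset.sum_nonneg fun j _ => norm_nonneg _
    have hc₁ : 0 ≤ B6.c1 (d261 δ₀) δ₀ (1 / 4) := B6RandomWalk.c1_nonneg _ _ _
    have hcard : (0 : ℝ) ≤ Fintype.card (Fin (d + 1)) := Nat.cast_nonneg _
    have hΛ : (0 : ℝ) ≤ ((ℓ : ℝ) + 1) ^ 4 := by positivity
    have hk : 0 ≤ kappa385 (M₂ * (∑ j, ‖b j‖) * B₀)
        ((((2 + 8 * (1 : ℝ) ^ 2 * (1 / 4)) * Fintype.card (Fin (d + 1)) + 2 * Fintype.card (Fin (d + 1)) * 2) * M₂ * (∑ j, ‖b j‖) *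
          Real.exp (δ₀ * (2 * ((d : ℝ) + 1))))) 0 0 (((ℓ : ℝ) + 1) ^ 4) (B6.c1 (d261 δ₀) δ₀ (1 / 4)) :=
      kappa385_nonneg (by positivity) (by positivity) le_rfl le_rfl hΛ hc₁
    positivity

/-! ## §4 ★★★ The hypothesis `hout` of the family transfer, assembled -/

/-- ★★★ **THE HYPOTHESIS `hout` OF `B9SectBStepFamilyTransfer.sectBStepPrinted_of_family`, LITERALLY**, for `Gp₁ := KSC` (augmented coded readings) and
`Gp₂ :=` the record's `G′` family read along the decoding (`pullK … (kernelFamilyS … (GpY par) par)`), any shared `G`-family `GA` whose Hölder ∕ (3.44) ∕ (3.45)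
members are nonnegative (every reading by suprema) and any shared `Cinv`: for all input constants and every cap `a > 0` there are the M-threshold `Mo` of
`hconv_KSC`, the caps `ao = 1`, `a′ = min a (1/4)`, and the output constants `(max B₀ B″, min δ₀ (δ₀/2), B_β, B_ε, B_εβ, B₁, δ₁)` such that at every
coded product over a regular base with the multiplier in the coded class, the block of `KSC` gives the block of the record family (`hconv_KSC` ∘
`thms_pullK_prod_of_KSC`).  With `hin_KSC` (`B9SectBGpTransferInY`) this completes the two analytic inputs of the family transfer; `hAn` is the consumer's.
[cite: Balaban1985BackgroundPropagators, Thm 3.4 p.400, p.403 l.1–9 («of course with different constants»), (3.35)–(3.37) p.396, (3.42)–(3.48) pp.397–399] -/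
theorem hout_KSC (hG1 : ∀ u : 𝔸ˣ, u ∈ G → ‖(u : 𝔸)‖ ≤ 1) {M₂ : ℝ} (hM₂ : 0 ≤ M₂) (hrepr : ∀ (v : 𝔸) (j : ι), |b.repr v j| ≤ M₂ * ‖v‖)
    (hι : ∀ (x : MemberY d ℓ hd hL b₀ b₁ Mstar) (s : BlkY x.toKIdx), β x.toKIdx.hN x.toKIdx.D x.toKIdx.hk (ιB x s) = s)
    {Cq : ℝ} (hC37 : ∀ x β' U a, C37 x β' U a → GVal G x.toKIdx U ∧ CplxLettersY G x (par x) (ιB x) Cq β' U a) (c35 : ℝ) (dC : ℕ)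
    (GA : ∀ x : MemberY d ℓ hd hL b₀ b₁ Mstar, B9.KernelFamily (geo9Y x) (codingYx G x (C37 x) (C38 x)).bg)
    (Cinv : ∀ x : MemberY d ℓ hd hL b₀ b₁ Mstar, B9.SiteKernel (geo9Y x) (codingYx G x (C37 x) (C38 x)).bg)
    (hGA : ∀ (x : MemberY d ℓ hd hL b₀ b₁ Mstar) (c : (codingYx G x (C37 x) (C38 x)).bg.Cfg),
      (∀ lam β' ζ, 0 ≤ (GA x).h1 c lam β' ζ) ∧ (∀ lam y, 0 ≤ (GA x).e4 c lam y) ∧ (∀ lam β' ζ, 0 ≤ (GA x).h2 c lam β' ζ)) :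
    ∀ (B₀ δ₀ : ℝ) (Bβ Bε : ℝ → ℝ) (Bεβ : ℝ → ℝ → ℝ) (B₁ δ₁ : ℝ) (acap : ℝ), 0 < B₀ → 0 < δ₀ → 0 < B₁ → 0 < δ₁ → 0 < acap →
      ∃ (Mo ao a' B₀' δ₀' : ℝ) (Bβ' Bε' : ℝ → ℝ) (Bεβ' : ℝ → ℝ → ℝ) (B₁' δ₁' : ℝ),
        0 < ao ∧ 0 < a' ∧ a' ≤ acap ∧ 0 < B₀' ∧ 0 < δ₀' ∧ 0 < B₁' ∧ 0 < δ₁' ∧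
        ∀ x : MemberY d ℓ hd hL b₀ b₁ Mstar, Mo ≤ (geo9Y x).M → ∀ α₀ : ℝ, 0 < α₀ → (geo9Y x).M * α₀ ≤ ao →
          ∀ c : (codingYx G x (C37 x) (C38 x)).bg.Cfg, (codingYx G x (C37 x) (C38 x)).bg.Reg335 c35 α₀ c →
          ∀ α₁ : ℝ, 0 < α₁ → α₁ ≤ a' → ∀ c' : (codingYx G x (C37 x) (C38 x)).bg.Cfg, (codingYx G x (C37 x) (C38 x)).bg.Cplx337 α₁ c c' →
          B9.Thms31to33IneqAt dC (KSC G x (par x) (C37 x) (C38 x)) (GA x) (Cinv x) B₀ δ₀ Bβ Bε Bεβ B₁ δ₁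
              ((codingYx G x (C37 x) (C38 x)).bg.mul c' c) →
          B9.Thms31to33IneqAt dC (pullK (codingYx G x (C37 x) (C38 x))
              (kernelFamilyS x.toKIdx (bg9Y 𝔸 G x) (fun U => U) (GpY x.toKIdx (par x)) (par x))) (GA x) (Cinv x)
              B₀' δ₀' Bβ' Bε' Bεβ' B₁' δ₁' ((codingYx G x (C37 x) (C38 x)).bg.mul c' c) := by
  intro B₀ δ₀ Bβ Bε Bεβ B₁ δ₁ acap hB₀ hδ₀ hB₁ hδ₁ hacap
  obtain ⟨Mo, B'', hB'', H⟩ := hconv_KSC G par b ιB C37 C38 hG1 hM₂ hrepr hι hC37 B₀ δ₀ hB₀.le hδ₀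
  refine ⟨Mo, 1, min acap (1 / 4), max B₀ B'', min δ₀ (δ₀ / 2), Bβ, Bε, Bεβ, B₁, δ₁, one_pos, lt_min hacap (by norm_num), min_le_left _ _,
    lt_max_of_lt_left hB₀, lt_min hδ₀ (by linarith), hB₁, hδ₁, fun x hM α₀ _ _ c _ α₁ _ hα₁a c' h37 hT => ?_⟩
  obtain ⟨U, a, rfl, rfl, hC⟩ := (codingYx G x (C37 x) (C38 x)).exists_of_bg_Cplx337 h37
  have hα₁c : α₁ ≤ 1 / 4 := le_trans hα₁a (min_le_right _ _)
  have hE : EBlock (KSC G x (par x) (C37 x) (C38 x)) B₀ δ₀ (.prod U a) := hT.1.1.1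
  exact thms_pullK_prod_of_KSC G x (par x) (C37 x) (C38 x) dC (GA x) (Cinv x) (hGA x _).1 (hGA x _).2.1 (hGA x _).2.2 hB₀.le hT hB''
    (H x hM U a α₁ hα₁c hC hE)

end Family

end Literature.MathematicalPhysics.QuantumFieldTheory.Balaban1983to89.B9SectBGpTransferConvY
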